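import Summits.QuantumFields.YangMills.Theorems.BalabanUVNodesN13AERowOfAveragedGibbsMeasureBoundAtRecord13SepCoPH

/-!
# BalabanUVNodes ∕ N13 — THE ENGINES' N13 FAMILY `h13F` («(2.50) at EVERY field of level 0 ∧ `dV`-a.e. at levels ≥ 1, in `B16.UVIneq` letters at the record datum» — dag-n24-c's Part 37 ∕ dag-n13-w1's
# (3a) `h0`∕`hae` display) SUPPLIED FROM THE MEASURE ROAD: the level-0 row + the selector laws + ONE MEASURE INEQUALITY on the averaged Gibbs measures + the a.e. LOWER half at levels ≥ 1
# (Track A, DAG node N13 = [B16]; cluster K1 — K1⁹ `StabilityBRunRowsAtRecordR13SepCoPHV` = stmt-QuantumFields-27364, helper; seat `pub-ymgap-dag-n13-w3` g4; sequel of p622818; 2026-08-28; count-neutral)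

HONEST FRAMING.  Count-neutral BY-NAME JUNCTION; nothing of Bałaban's is asserted or refuted.  dag-n24-c g11's K1⁹-by-name road (Part 37, p626256) and the K1 «v9» slot suppliers (dag-n13-w1 p622796
`exists_revision₁₃_endStatementBPrinted_of_ae`) display N13's content as the family `h13F` = «∃ γ > 0, ∃ em ep, (2.50) in `B16.UVIneq` letters at `(datumOfRecord₁₃SepCoPH θ h).C`: at EVERY field of
level 0 on the γ-window, and `dV`-a.e. at levels `k+1 ≤ K`».  THIS FILE produces that family from this seat's VERSION-FREE road: (§1) ★★★ `h0_hae_of_row0_of_selLaws_towerMeasureUV_of_aeLower` —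
the level-0 two-sided row (every field; dag-n13-w1's level-0 editions at the K0-class witnesses), the tree's selector laws (i)(ii), the MEASURE INEQUALITY `hμUV`
«`(π_{k+1})_*(ρ₀·dU_0)(S) ≤ ofReal (e^{ep(g_{k+1})|T₁^{(k+1)}|}) · Haar_{k+1}(S)`» on the γ-window (p622818 §0 `towerMeasure_le_iff_ae_densOfRecord₁₃_le`: it IS the a.e. upper half), and the a.e.
LOWER member at levels ≥ 1 (the (L2ˢ)-type input of the n13 lanes, e.g. dag-n13-w2's `ae_uvLower_of_ae_smallLocus` p621421) ⟹ the pair `(h0, hae)`; (§2) ★★ `h13F_of_row0_of_selLaws_towerMeasureUV_of_aeLower`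
— the ∃-packaged family.  DISPLAYED: `hμUV` = (2.50)'s upper half for the unrenormalised k-fold averaged Gibbs MEASURE (Bałaban's theorem proper at the tree's selector laws), the a.e. lower
member ([III] Thm 2 at the all-small history), the level-0 row, the selector laws — nobody's theorem here.  N13 NOT discharged; K1⁹ NEITHER proved NOR refuted; no stub closed; counts unmoved
(typed 28∕28 · discharged 5∕27 · Track A 5∕28).  ONE finite four-torus programme at fixed `ε = L^{−K}`; R4 closes the conditional finite-𝕋⁴ rung `BalabanLadder.UV` only — the Yang–Mills mass gap
(Clay) is NOT proved by any of this; nothing continuum ∕ ℝ⁴ ∕ OS.  No `sorry`, `def`, `instance`, `notation`.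

Sources: [Balaban1989LargeFieldII] Thm 1 + (0.1) pp.355–356; [Balaban1988Convergent] Thm 2 p.263, (2.49)–(2.50) p.264, (3.1) p.264; [Balaban1989LargeFieldI] (0.3) p.176, (i)–(ii) p.177.
-/

noncomputable section

open MeasureTheory
open scoped BigOperators ENNReal Matrix.Norms.L2Operator

namespace Summit.QuantumFields.YangMills.BalabanUVNodes.N13H13FamilyOfTowerMeasureAtRecord13SepCoPH

open Literature.MathematicalPhysics.QuantumFieldTheory.Balaban1983to89
open T4Continuum Node00 B14.Eq218Concrete
open Summit.QuantumFields.YangMills.BalabanUVNodes.N13AERowOfAveragedGibbsMeasureBoundAtRecord13SepCoPH (towerMeasure_le_iff_ae_densOfRecord₁₃_le)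
open Summit.QuantumFields.YangMills.BalabanUVNodes.N13Cor3AEIffUpToVersionAtRecord13 (uvIneq_at_record₁₃SepCoPH_iff)

variable (F : T4Family) (N : ℕ) [NeZero N] (θ : Stage13HParams F N) (h : θ.Provisos₁₃SepCoPH F N)

open Classical in
/-- **★★★ THE PAIR `(h0, hae)` OF THE ENGINES' N13 FAMILY FROM THE MEASURE ROAD.**  Level 0: the two-sided row at every field (record letters) IS `B16.UVIneq … 0 V …` (`uvIneq_at_record₁₃SepCoPH_iff`,
`Iff.rfl`).  Levels `k+1 ≤ K` on the γ-window: UPPER member `dV`-a.e. ⟸ the selector laws (i)(ii) at levels `≤ k+1` + the MEASURE INEQUALITY `hμUV` (p622818 §0: the row IS the a.e. bound);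
LOWER member `dV`-a.e. = the displayed input `haeLow`; together `∀ᵐ V, B16.UVIneq … (k+1) V (em g_{k+1}) (ep g_{k+1})`.  CONDITIONAL; nothing of Bałaban asserted.
[cite: Balaban1989LargeFieldII, (0.1) pp.355–356; Balaban1988Convergent, (2.49)–(2.50) p.264, (3.1) p.264; Balaban1989LargeFieldI, (0.3) p.176, (i)–(ii) p.177] -/
theorem h0_hae_of_row0_of_selLaws_towerMeasureUV_of_aeLower {γ : ℝ} {em ep : ℝ → ℝ}
    (hrow0 : ∀ P : B12.RunParams, ((datumOfRecord₁₃SepCoPH F N θ h).C P).flow.InInterval γ P.K → ∀ U : GaugeField (F.P P.K) 0 (SU N),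
      chiβOfRecord₁₃ F N θ.toStage13Params P.K (gOfRecord₁₃ F N θ.toStage13Params P) 0 U *
            Real.exp (-(1 / (gOfRecord₁₃ F N θ.toStage13Params P 0) ^ 2 * wilsonBGOfRecord F N θ.εbg P 0 U)
              - em (gOfRecord₁₃ F N θ.toStage13Params P 0) * (Fintype.card (Site (F.P P.K) 0) : ℝ)) ≤ densOfRecord₁₃ F N θ.toStage13Params P 0 U ∧
        densOfRecord₁₃ F N θ.toStage13Params P 0 U ≤ Real.exp (ep (gOfRecord₁₃ F N θ.toStage13Params P 0) * (Fintype.card (Site (F.P P.K) 0) : ℝ)))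
    (hidem : ∀ (P : B12.RunParams) k, k < P.K → ∀ a, θ.ppSel P (gOfRecord₁₃ F N θ.toStage13Params P) (k + 1) (θ.ppSel P (gOfRecord₁₃ F N θ.toStage13Params P) (k + 1) a)
      = θ.ppSel P (gOfRecord₁₃ F N θ.toStage13Params P) (k + 1) a)
    (hdead : ∀ (P : B12.RunParams) j, j < P.K → ∀ a : SeqOfRecord F θ.ν θ.τ9.M (gOfRecord₁₃ F N θ.toStage13Params P) P.K (j + 1),
      θ.ppSel P (gOfRecord₁₃ F N θ.toStage13Params P) (j + 1) a ≠ a →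
      ∀ V, B15.BasicStep.fibreIntegral (fibOfSeq F θ.ν θ.τ9 P (gOfRecord₁₃ F N θ.toStage13Params P) (j + 1) a)
        (rterm (sliceOfRecord F N θ.ν θ.τ9.M P (gOfRecord₁₃ F N θ.toStage13Params P) (j + 1)
          (slotsTOfRecord F N θ.ν θ.τ9 (EOfRecord₁₃ F N θ.toStage13Params) (wOfRecord₉ F N θ.toStage9Params) θ.ppSel P (gOfRecord₁₃ F N θ.toStage13Params P) (j + 1))) a) V = 0)
    (hμUV : ∀ P : B12.RunParams, ((datumOfRecord₁₃SepCoPH F N θ h).C P).flow.InInterval γ P.K → ∀ k, k + 1 ≤ P.K → ∀ S : Set (GaugeField (F.P P.K) (k + 1) (SU N)), MeasurableSet S →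
      ((fieldMeasure (F.P P.K) 0 (SU N)).withDensity fun U =>
          ENNReal.ofReal (rhoZeroOfRecord F N P.K (gOfRecord₁₃ F N θ.toStage13Params P 0) (EOfRecord₁₃ F N θ.toStage13Params P) U)).map
        (Nat.rec (motive := fun j => GaugeField (F.P P.K) 0 (SU N) → GaugeField (F.P P.K) j (SU N)) id (fun j π => (avOfRecord F N P.K j).avg ∘ π) (k + 1)) S ≤
      ENNReal.ofReal (Real.exp (ep (gOfRecord₁₃ F N θ.toStage13Params P (k + 1)) * (Fintype.card (Site (F.P P.K) (k + 1)) : ℝ))) * fieldMeasure (F.P P.K) (k + 1) (SU N) S)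
    (haeLow : ∀ P : B12.RunParams, ((datumOfRecord₁₃SepCoPH F N θ h).C P).flow.InInterval γ P.K → ∀ k, k + 1 ≤ P.K →
      ∀ᵐ U ∂(fieldMeasure (F.P P.K) (k + 1) (SU N)),
        chiβOfRecord₁₃ F N θ.toStage13Params P.K (gOfRecord₁₃ F N θ.toStage13Params P) (k + 1) U *
            Real.exp (-(1 / (gOfRecord₁₃ F N θ.toStage13Params P (k + 1)) ^ 2 * wilsonBGOfRecord F N θ.εbg P (k + 1) U)
              - em (gOfRecord₁₃ F N θ.toStage13Params P (k + 1)) * (Fintype.card (Site (F.P P.K) (k + 1)) : ℝ)) ≤ densOfRecord₁₃ F N θ.toStage13Params P (k + 1) U) :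
    (∀ P : B12.RunParams, ((datumOfRecord₁₃SepCoPH F N θ h).C P).flow.InInterval γ P.K → ∀ V : GaugeField (F.P P.K) 0 (SU N),
        B16.UVIneq ((datumOfRecord₁₃SepCoPH F N θ h).C P) 0 V (em (((datumOfRecord₁₃SepCoPH F N θ h).C P).flow.g 0)) (ep (((datumOfRecord₁₃SepCoPH F N θ h).C P).flow.g 0))) ∧
      (∀ P : B12.RunParams, ((datumOfRecord₁₃SepCoPH F N θ h).C P).flow.InInterval γ P.K → ∀ k : ℕ, k + 1 ≤ P.K →
        ∀ᵐ V ∂fieldMeasure (F.P P.K) (k + 1) (SU N),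
          B16.UVIneq ((datumOfRecord₁₃SepCoPH F N θ h).C P) (k + 1) V (em (((datumOfRecord₁₃SepCoPH F N θ h).C P).flow.g (k + 1)))
            (ep (((datumOfRecord₁₃SepCoPH F N θ h).C P).flow.g (k + 1)))) := by
  refine ⟨fun P hP V => (uvIneq_at_record₁₃SepCoPH_iff F N θ h P 0 V _ _).2 (hrow0 P hP V), fun P hP k hk => ?_⟩
  have hup : ∀ᵐ V ∂fieldMeasure (F.P P.K) (k + 1) (SU N),
      densOfRecord₁₃ F N θ.toStage13Params P (k + 1) V ≤ Real.exp (ep (gOfRecord₁₃ F N θ.toStage13Params P (k + 1)) * (Fintype.card (Site (F.P P.K) (k + 1)) : ℝ)) :=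
    (towerMeasure_le_iff_ae_densOfRecord₁₃_le F N θ P h (k + 1) hk (fun j hj => hidem P j (lt_of_lt_of_le hj hk)) (fun j hj => hdead P j (lt_of_lt_of_le hj hk))
      _ (Real.exp_pos _).le).1 (hμUV P hP k hk)
  filter_upwards [hup, haeLow P hP k hk] with V hV hlow
  exact (uvIneq_at_record₁₃SepCoPH_iff F N θ h P (k + 1) V _ _).2 ⟨hlow, hV⟩

open Classical in
/-- **★★ THE ENGINES' N13 FAMILY `h13F`, ∃-PACKAGED** (dag-n24-c Part 37 ∕ dag-n13-w1 (3a) letters): from `0 < γ`, the level-0 row, the selector laws, the measure inequality and the a.e. lower member,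
«`∃ γ₁₃ > 0, ∃ em ep, h0 ∧ hae`» at `(datumOfRecord₁₃SepCoPH F N θ h).C`.  CONDITIONAL; N13 NOT discharged. [cite: Balaban1989LargeFieldII, (0.1) pp.355–356; Balaban1988Convergent, Cor. 3 (2.50) p.264 (bookkeeping)] -/
theorem h13F_of_row0_of_selLaws_towerMeasureUV_of_aeLower {γ : ℝ} (hγ : 0 < γ) {em ep : ℝ → ℝ}
    (hrow0 : ∀ P : B12.RunParams, ((datumOfRecord₁₃SepCoPH F N θ h).C P).flow.InInterval γ P.K → ∀ U : GaugeField (F.P P.K) 0 (SU N),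
      chiβOfRecord₁₃ F N θ.toStage13Params P.K (gOfRecord₁₃ F N θ.toStage13Params P) 0 U *
            Real.exp (-(1 / (gOfRecord₁₃ F N θ.toStage13Params P 0) ^ 2 * wilsonBGOfRecord F N θ.εbg P 0 U)
              - em (gOfRecord₁₃ F N θ.toStage13Params P 0) * (Fintype.card (Site (F.P P.K) 0) : ℝ)) ≤ densOfRecord₁₃ F N θ.toStage13Params P 0 U ∧
        densOfRecord₁₃ F N θ.toStage13Params P 0 U ≤ Real.exp (ep (gOfRecord₁₃ F N θ.toStage13Params P 0) * (Fintype.card (Site (F.P P.K) 0) : ℝ)))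
    (hidem : ∀ (P : B12.RunParams) k, k < P.K → ∀ a, θ.ppSel P (gOfRecord₁₃ F N θ.toStage13Params P) (k + 1) (θ.ppSel P (gOfRecord₁₃ F N θ.toStage13Params P) (k + 1) a)
      = θ.ppSel P (gOfRecord₁₃ F N θ.toStage13Params P) (k + 1) a)
    (hdead : ∀ (P : B12.RunParams) j, j < P.K → ∀ a : SeqOfRecord F θ.ν θ.τ9.M (gOfRecord₁₃ F N θ.toStage13Params P) P.K (j + 1),
      θ.ppSel P (gOfRecord₁₃ F N θ.toStage13Params P) (j + 1) a ≠ a →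
      ∀ V, B15.BasicStep.fibreIntegral (fibOfSeq F θ.ν θ.τ9 P (gOfRecord₁₃ F N θ.toStage13Params P) (j + 1) a)
        (rterm (sliceOfRecord F N θ.ν θ.τ9.M P (gOfRecord₁₃ F N θ.toStage13Params P) (j + 1)
          (slotsTOfRecord F N θ.ν θ.τ9 (EOfRecord₁₃ F N θ.toStage13Params) (wOfRecord₉ F N θ.toStage9Params) θ.ppSel P (gOfRecord₁₃ F N θ.toStage13Params P) (j + 1))) a) V = 0)
    (hμUV : ∀ P : B12.RunParams, ((datumOfRecord₁₃SepCoPH F N θ h).C P).flow.InInterval γ P.K → ∀ k, k + 1 ≤ P.K → ∀ S : Set (GaugeField (F.P P.K) (k + 1) (SU N)), MeasurableSet S →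
      ((fieldMeasure (F.P P.K) 0 (SU N)).withDensity fun U =>
          ENNReal.ofReal (rhoZeroOfRecord F N P.K (gOfRecord₁₃ F N θ.toStage13Params P 0) (EOfRecord₁₃ F N θ.toStage13Params P) U)).map
        (Nat.rec (motive := fun j => GaugeField (F.P P.K) 0 (SU N) → GaugeField (F.P P.K) j (SU N)) id (fun j π => (avOfRecord F N P.K j).avg ∘ π) (k + 1)) S ≤
      ENNReal.ofReal (Real.exp (ep (gOfRecord₁₃ F N θ.toStage13Params P (k + 1)) * (Fintype.card (Site (F.P P.K) (k + 1)) : ℝ))) * fieldMeasure (F.P P.K) (k + 1) (SU N) S)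
    (haeLow : ∀ P : B12.RunParams, ((datumOfRecord₁₃SepCoPH F N θ h).C P).flow.InInterval γ P.K → ∀ k, k + 1 ≤ P.K →
      ∀ᵐ U ∂(fieldMeasure (F.P P.K) (k + 1) (SU N)),
        chiβOfRecord₁₃ F N θ.toStage13Params P.K (gOfRecord₁₃ F N θ.toStage13Params P) (k + 1) U *
            Real.exp (-(1 / (gOfRecord₁₃ F N θ.toStage13Params P (k + 1)) ^ 2 * wilsonBGOfRecord F N θ.εbg P (k + 1) U)
              - em (gOfRecord₁₃ F N θ.toStage13Params P (k + 1)) * (Fintype.card (Site (F.P P.K) (k + 1)) : ℝ)) ≤ densOfRecord₁₃ F N θ.toStage13Params P (k + 1) U) :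
    ∃ γ₁₃ : ℝ, 0 < γ₁₃ ∧ ∃ em ep : ℝ → ℝ,
      (∀ P : B12.RunParams, ((datumOfRecord₁₃SepCoPH F N θ h).C P).flow.InInterval γ₁₃ P.K → ∀ V : GaugeField (F.P P.K) 0 (SU N),
          B16.UVIneq ((datumOfRecord₁₃SepCoPH F N θ h).C P) 0 V (em (((datumOfRecord₁₃SepCoPH F N θ h).C P).flow.g 0)) (ep (((datumOfRecord₁₃SepCoPH F N θ h).C P).flow.g 0))) ∧
        (∀ P : B12.RunParams, ((datumOfRecord₁₃SepCoPH F N θ h).C P).flow.InInterval γ₁₃ P.K → ∀ k : ℕ, k + 1 ≤ P.K →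
          ∀ᵐ V ∂fieldMeasure (F.P P.K) (k + 1) (SU N),
            B16.UVIneq ((datumOfRecord₁₃SepCoPH F N θ h).C P) (k + 1) V (em (((datumOfRecord₁₃SepCoPH F N θ h).C P).flow.g (k + 1)))
              (ep (((datumOfRecord₁₃SepCoPH F N θ h).C P).flow.g (k + 1)))) :=
  ⟨γ, hγ, em, ep, h0_hae_of_row0_of_selLaws_towerMeasureUV_of_aeLower F N θ h hrow0 hidem hdead hμUV haeLow⟩

end Summit.QuantumFields.YangMills.BalabanUVNodes.N13H13FamilyOfTowerMeasureAtRecord13SepCoPH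

end
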